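import Literature.NumberTheory.EllipticCurves.SubgroupSelmer
import Literature.NumberTheory.GaloisRepresentations.ContinuousH1
import Mathlib.Topology.Algebra.ClopenNhdofOne
import Mathlib.Topology.Algebra.OpenSubgroup
import HarnessLib

/-!
# Route `EisensteinPrimes` (rung K5), crux 2 `GoodLatticeBDPValue`, line `halves` v8, stub
# `stub_locallyTrivialOverTower`, brick F5(i): a CONTINUOUS COCYCLE OF A PROFINITE GROUP WITH VALUES IN
# A `p`-PRIMARY DISCRETE MODULE, TRIVIAL ON A NORMAL SUBGROUP OF PRO-`p′` "INDEX", IS A COBOUNDARY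
# (helper for stmt-BirchSwinnertonDyer-19032)

Cell `bsd-eis`, seat `bsd-eis-k5-c2` (gen 9). The group-cohomological engine behind "unramified ⇒
locally trivial over `K̃_∞`" (the displayed stub `stub_locallyTrivialOverTower` of halves v8): for a
profinite `G` acting continuously (open stabilisers) on a discrete `p`-primary module `N`, a closed…
normal subgroup `I ≤ G` such that EVERY OPEN NORMAL SUBGROUP CONTAINING `I` HAS INDEX PRIME TO `p`
("`G/I` is pro-prime-to-`p`"), every continuous crossed homomorphism `z : G → N` whose restriction to
`I` is principal is principal (`exists_eq_smul_sub_of_coprime_index`): subtract the principal part;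
the difference vanishes on `V = I · W` for a small open normal `W` (finitely many values, open
stabilisers, an open neighbourhood of `1` where `z = 0`), so it is a cocycle of the finite group `G/V`
of order `m` prime to `p` with `p^k`-torsion values; `m · z = ∂(−Σ_q z(q))` (the averaging identity,
`sum_smul_eq`) and Bézout `a m + b p^k = 1` finish. Applied later (F5(ii)–(iv)) to
`G = Gal(K̄_w/K̃_{∞,η}) ⊇ I =` its inertia group, whose quotient is pro-`p′` at the places over
`S ∖ {v}`. Theorems only; no definition, no named fact, no instance, no `sorry`. HONEST FRAMING:
closes nothing by itself (`--supports`).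
References: [SerreGaloisCohomology1997] I §2.2, I §2.4 (Prop. 9: `cd_p = 0` for pro-`p′` groups);
[NeukirchSchmidtWingberg2008] (1.6.2) (`H^n(G, A)` is killed by `#G`).
-/

set_option autoImplicit false
set_option linter.dupNamespace false

noncomputable section

open scoped Classical Pointwise
open Literature.NumberTheory.EllipticCurves Literature.NumberTheory.GaloisRepresentations

namespace Summit.BirchSwinnertonDyer.BirchSwinnertonDyer.Theorems.GreenbergFullAtSelmer

variable {p : ℕ}
  {G : Type} [Group G] [TopologicalSpace G] [IsTopologicalGroup G] [CompactSpace G]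
  [TotallyDisconnectedSpace G]
  {N : Type} [AddCommGroup N] [DistribMulAction G N] [TopologicalSpace N] [DiscreteTopology N]

omit [TopologicalSpace G] [IsTopologicalGroup G] [CompactSpace G] [TotallyDisconnectedSpace G]
  [TopologicalSpace N] [DiscreteTopology N] in
/-- **The averaging identity** for a crossed homomorphism `f` of a group `G` which is constant on the
cosets of a normal subgroup `V` of finite index `m` acting trivially on its values: for
`s = Σ_{q ∈ G/V} f(q)`, `m • f(g) = s − g • s` — i.e. `#(G/V) · f` is the coboundary of `−s`.
[cite: NeukirchSchmidtWingberg2008, (1.6.2)] -/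
theorem card_nsmul_eq_sub_smul_sum (V : Subgroup G) [Fintype (G ⧸ V)] (f : G → N)
    (hf : ∀ g h : G, f (g * h) = f g + g • f h) (F : G ⧸ V → N) (hF : ∀ x : G, F (x : G ⧸ V) = f x)
    (g : G) :
    Fintype.card (G ⧸ V) • f g = (∑ q : G ⧸ V, F q) - g • ∑ q : G ⧸ V, F q := by
  -- reindex the sum by left multiplication by `g`
  have hsum : ∑ q : G ⧸ V, F (g • q) = ∑ q : G ⧸ V, F q :=
    Fintype.sum_equiv (MulAction.toPerm g) _ _ (fun q ↦ rfl)
  have hterm : ∀ q : G ⧸ V, F (g • q) = f g + g • F q := fun q ↦ by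
    induction q using QuotientGroup.induction_on with
    | H x => rw [MulAction.Quotient.smul_coe, smul_eq_mul, hF, hF, hf]
  simp_rw [hterm, Finset.sum_add_distrib, Finset.sum_const, Finset.card_univ, ← Finset.smul_sum] at hsum
  rw [eq_sub_iff_add_eq]
  exact hsum

/-- **A continuous crossed homomorphism of a profinite group, with values in a discrete `p`-primary
module with open stabilisers, which VANISHES on a normal subgroup `I` such that every open normal
subgroup containing `I` has index prime to `p`, is principal.** [cite: SerreGaloisCohomology1997, I §2.4 (Prop. 9)]
[cite: NeukirchSchmidtWingberg2008, (1.6.2)] -/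
theorem exists_eq_smul_sub_of_coprime_index_of_vanishing
    (hstab : ∀ n : N, IsOpen (MulAction.stabilizer G n : Set G))
    (hN : ∀ n : N, ∃ k : ℕ, p ^ k • n = 0)
    (I : Subgroup G) [I.Normal]
    (hind : ∀ V : Subgroup G, V.Normal → IsOpen (V : Set G) → I ≤ V → Nat.Coprime p V.index)
    (z : contOneCocycles (discreteTopRep G N)) (hzI : ∀ i ∈ I, z.1 i = 0) :
    ∃ n : N, ∀ g : G, z.1 g = g • n - n := by
  have hz : ∀ g h : G, z.1 (g * h) = z.1 g + g • z.1 h := z.2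
  -- finitely many values, uniformly `p^k`-torsion
  have hfin : (Set.range z.1).Finite := (isCompact_range z.1.continuous).finite_of_discrete
  obtain ⟨k, hk⟩ : ∃ k : ℕ, ∀ g : G, p ^ k • z.1 g = 0 := by
    have key : ∀ s : Finset N, (∀ m ∈ s, ∃ k : ℕ, p ^ k • m = 0) → ∃ k : ℕ, ∀ m ∈ s, p ^ k • m = 0 := by
      intro s
      induction s using Finset.induction_on with
      | empty => exact fun _ ↦ ⟨0, fun m hm ↦ (Finset.notMem_empty m hm).elim⟩
      | @insert a s ha ih =>
        intro h
        obtain ⟨k₁, hk₁⟩ := h a (Finset.mem_insert_self a s)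
        obtain ⟨k₂, hk₂⟩ := ih fun m hm ↦ h m (Finset.mem_insert_of_mem hm)
        refine ⟨k₁ + k₂, fun m hm ↦ ?_⟩
        rcases Finset.mem_insert.mp hm with rfl | hm
        · rw [pow_add, mul_comm, mul_smul, hk₁, smul_zero]
        · rw [pow_add, mul_smul, hk₂ m hm, smul_zero]
    obtain ⟨k, hk⟩ := key hfin.toFinset fun m _ ↦ hN m
    exact ⟨k, fun g ↦ hk _ (hfin.mem_toFinset.mpr ⟨g, rfl⟩)⟩
  -- a small open normal subgroup `W`: `z = 0` on `W` and `W` fixes every value of `z`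
  have hU : IsOpen ({g : G | z.1 g = 0} ∩ ⋂ m ∈ Set.range z.1, (MulAction.stabilizer G m : Set G)) :=
    ((isOpen_discrete ({0} : Set N)).preimage z.1.continuous).inter
      (hfin.isOpen_biInter fun m _ ↦ hstab m)
  have h1U : (1 : G) ∈ {g : G | z.1 g = 0} ∩ ⋂ m ∈ Set.range z.1, (MulAction.stabilizer G m : Set G) :=
    ⟨contOneCocycles.apply_one z, Set.mem_iInter₂.mpr fun m _ ↦ one_smul G m⟩
  obtain ⟨W, hW⟩ := ProfiniteGrp.exist_openNormalSubgroup_sub_open_nhds_of_one hU h1U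
  have hWz : ∀ w ∈ W, z.1 w = 0 := fun w hw ↦ (hW hw).1
  have hWfix : ∀ w ∈ W, ∀ g : G, w • z.1 g = z.1 g := fun w hw g ↦
    (Set.mem_iInter₂.mp (hW hw).2) (z.1 g) ⟨g, rfl⟩
  -- `V = I ⊔ W`, open normal, contains `I`
  set V : Subgroup G := I ⊔ (W : Subgroup G) with hVdef
  haveI : V.Normal := Subgroup.sup_normal I (W : Subgroup G)
  have hVopen : IsOpen (V : Set G) := Subgroup.isOpen_mono le_sup_right W.isOpen
  have hIV : I ≤ V := le_sup_left
  -- `z` vanishes on `V` and `V` fixes the values of `z`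
  have hIfix : ∀ i ∈ I, ∀ g : G, i • z.1 g = z.1 g := fun i hi g ↦ by
    have h1 := hz i g
    have h2 := hz g (g⁻¹ * i * g)
    rw [hzI i hi, zero_add] at h1
    rw [hzI _ ((inferInstance : I.Normal).conj_mem' i hi g), smul_zero, add_zero,
      show g * (g⁻¹ * i * g) = i * g by group] at h2
    rw [← h1, h2]
  have hVz : ∀ v ∈ V, z.1 v = 0 := by
    intro v hv
    have hv' : v ∈ ((I ⊔ (W : Subgroup G) : Subgroup G) : Set G) := hv
    rw [Subgroup.normal_mul] at hv'
    obtain ⟨i, hi, w, hw, rfl⟩ := Set.mem_mul.mp hv'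
    rw [hz, hzI i hi, hWz w hw, smul_zero, add_zero]
  have hVfix : ∀ v ∈ V, ∀ g : G, v • z.1 g = z.1 g := by
    intro v hv g
    have hv' : v ∈ ((I ⊔ (W : Subgroup G) : Subgroup G) : Set G) := hv
    rw [Subgroup.normal_mul] at hv'
    obtain ⟨i, hi, w, hw, rfl⟩ := Set.mem_mul.mp hv'
    rw [mul_smul, hWfix w hw, hIfix i hi]
  have hVconst : ∀ (g v : G), v ∈ V → z.1 (g * v) = z.1 g := fun g v hv ↦ by
    rw [hz, hVz v hv, smul_zero, add_zero]
  -- the finite quotient and the averaging identity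
  haveI : Finite (G ⧸ V) := Subgroup.quotient_finite_of_isOpen V hVopen
  letI := Fintype.ofFinite (G ⧸ V)
  have hcard : Fintype.card (G ⧸ V) = V.index := by
    rw [Subgroup.index_eq_card, Nat.card_eq_fintype_card]
  have hm : Nat.Coprime p (Fintype.card (G ⧸ V)) := hcard ▸ hind V inferInstance hVopen hIV
  let F : G ⧸ V → N := fun q ↦ Quotient.liftOn' q z.1 (fun a b hab ↦ by
      have h : a⁻¹ * b ∈ V := QuotientGroup.leftRel_apply.mp hab
      have := hVconst a (a⁻¹ * b) h
      rw [mul_inv_cancel_left] at this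
      exact this.symm)
  have hF : ∀ x : G, F (x : G ⧸ V) = z.1 x := fun x ↦ rfl
  have havg := card_nsmul_eq_sub_smul_sum V z.1 hz F hF
  set s : N := ∑ q : G ⧸ V, F q with hs
  -- Bézout: `a * card + b * p^k = 1`
  have hcop : IsCoprime (Fintype.card (G ⧸ V) : ℤ) ((p : ℤ) ^ k) := by
    rw [← Nat.cast_pow, Nat.isCoprime_iff_coprime]
    exact (Nat.Coprime.pow_left k hm).symm
  obtain ⟨a, b, hab⟩ := hcop
  refine ⟨-(a • s), fun g ↦ ?_⟩
  have hg := havg g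
  have key : z.1 g = (a * Fintype.card (G ⧸ V) + b * (p : ℤ) ^ k) • z.1 g := by rw [hab, one_smul]
  rw [key, add_smul, mul_smul, mul_smul, natCast_zsmul, hg, ← Nat.cast_pow, natCast_zsmul, hk,
    smul_zero, add_zero, smul_sub, smul_neg, sub_neg_eq_add, smul_comm g a s]
  abel

/-- **Class-level form**: if the restriction of the class of `z` to `I` vanishes in the weak sense
that `z|_I` is the coboundary of some `m ∈ N`, then `z` is principal (apply the previous theorem to
`z − ∂m`). [cite: SerreGaloisCohomology1997, I §2.4 (Prop. 9)] -/
theorem exists_eq_smul_sub_of_coprime_index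
    (hstab : ∀ n : N, IsOpen (MulAction.stabilizer G n : Set G))
    (hN : ∀ n : N, ∃ k : ℕ, p ^ k • n = 0)
    (I : Subgroup G) [I.Normal]
    (hind : ∀ V : Subgroup G, V.Normal → IsOpen (V : Set G) → I ≤ V → Nat.Coprime p V.index)
    (z : contOneCocycles (discreteTopRep G N)) {m : N} (hzI : ∀ i ∈ I, z.1 i = i • m - m) :
    ∃ n : N, ∀ g : G, z.1 g = g • n - n := by
  -- the principal crossed homomorphism of `m`
  have hcont : Continuous fun g : G ↦ g • m - m := by
    have h1 : Continuous fun g : G ↦ g • m := by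
      refine continuous_def.mpr fun U _ ↦ ?_
      have : (fun g : G ↦ g • m) ⁻¹' U = ⋃ n ∈ U, {g : G | g • m = n} := by
        ext g; simp
      rw [this]
      refine isOpen_biUnion fun n _ ↦ ?_
      by_cases hne : {g : G | g • m = n}.Nonempty
      · obtain ⟨g₀, hg₀⟩ := hne
        have heq : {g : G | g • m = n} = (fun g ↦ g₀⁻¹ * g) ⁻¹' (MulAction.stabilizer G m : Set G) := by
          ext g
          simp only [Set.mem_setOf_eq, Set.mem_preimage, SetLike.mem_coe, MulAction.mem_stabilizer_iff]
          rw [mul_smul, inv_smul_eq_iff, hg₀]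
        rw [heq]
        exact (hstab m).preimage (continuous_const.mul continuous_id)
      · rw [Set.not_nonempty_iff_eq_empty.mp hne]
        exact isOpen_empty
    exact h1.sub continuous_const
  let cb : contOneCocycles (discreteTopRep G N) :=
    ⟨⟨fun g ↦ g • m - m, hcont⟩, fun g h ↦ by
      change (g * h) • m - m = (g • m - m) + g • (h • m - m)
      rw [mul_smul, smul_sub]
      abel⟩
  obtain ⟨n, hn⟩ := exists_eq_smul_sub_of_coprime_index_of_vanishing hstab hN I hind (z - cb)
    (fun i hi ↦ by
      change z.1 i - (i • m - m) = 0
      rw [hzI i hi, sub_self])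
  refine ⟨n + m, fun g ↦ ?_⟩
  have h := hn g
  change z.1 g - (g • m - m) = g • n - n at h
  rw [smul_add]
  linear_combination (norm := abel) h

end Summit.BirchSwinnertonDyer.BirchSwinnertonDyer.Theorems.GreenbergFullAtSelmer

end
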